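import Literature.Topology.FourManifolds.SphereProductMiddleHomology
import Literature.Topology.FourManifolds.OpenTraceSimplyConnected
import Literature.AlgebraicTopology.SingularHomology.SimplyConnectedH1
import Mathlib.LinearAlgebra.Basis.Prod
import Mathlib.LinearAlgebra.Dimension.Constructions
import Mathlib.Algebra.Category.ModuleCat.Biproducts
import HarnessLib

/-!
# Homology and fundamental group of a tree-shaped union of open sets

Topic `Literature/Topology/FourManifolds` (fact seat of
`Literature.Topology.FourManifolds.HomotopySphere.exists_intersectionForm_equivalent_e8Form`,
Kosinski's `E₈` plumbing `M(4m)`, *Differential Manifolds* (1993), VI.12). Kosinski reads the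
global invariants of the plumbing `M(2k)` of `g` disc bundles along a TREE from its handle
presentation: VI.(11.5) "`B` has the homotopy type of a wedge of `g` `k`-spheres" (so
`Hₖ(B) = gℤ` and `Hᵢ(B) = 0` in all other positive dimensions, used in the proof of VI.(11.6) and in
VI.(12.2)), the plumbing being done "according to a tree" (VI.12, p. 121, weighted trees). For a
plumbing realised as a union of open pieces `U₀, …, U_r` (thickened disc bundles) glued along a
tree — `Uᵥ` meets `U_{parent v}` in a contractible plumbing box and is disjoint from every other
earlier piece — the same invariants follow from the Mayer–Vietoris sequence and from van Kampen's
theorem with trivial groups, by induction over the leaves. This file proves these two inductions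
for an arbitrary topological space (A. Hatcher, *Algebraic Topology* (2002), §2.2 pp. 149–150 and
Lemma 1.15), in the form consumed by the handlebody criterion
`HomotopySphere.exists_intersectionForm_equivalent_e8Form_of_handlebody`
(`HomotopySpheresE8HandlebodyReduction.lean`: `Hᵢ(W) = 0` for `0 < i ≠ k`, `Hₖ(W)` free of
finite rank, `W` connected):

* `isZero_singularHomology_union`, `singularHomology_union_decomp`,
  `free_singularHomology_union` — two open pieces: if `Hₙ₊₁(A ∩ B) = Hₙ(A ∩ B) = 0` then
  `Hₙ₊₁(A ∪ B) = i_{A*} Hₙ₊₁(A) ⊕ i_{B*} Hₙ₊₁(B)` (set form of `mayerVietoris.isIso_ψ_of_isZero`),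
  so it vanishes, resp. is free of rank `rank Hₙ₊₁(A) + rank Hₙ₊₁(B)`, with the pieces
  (`free_of_decomp`: a basis of an internal direct sum; products of modules are avoided);
* `biUnionLE_inter_eq` — the combinatorics of a tree-shaped cover indexed by `Fin (r + 1)` with
  a parent function `parent v < v`: `(⋃_{v ≤ i} Uᵥ) ∩ U_{i+1} = U_{i+1} ∩ U_{parent (i+1)}`;
* `isZero_singularHomology_of_treeCover` — **`Hₙ₊₁(X) = 0`** when all `Hₙ₊₁(Uᵥ) = 0` and the
  edge intersections have `Hₙ₊₁ = Hₙ = 0`;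
* `free_singularHomology_of_treeCover` — **`Hₙ₊₁(X)` is free of rank `Σᵥ rank Hₙ₊₁(Uᵥ)`** (and
  finitely generated) when the `Hₙ₊₁(Uᵥ)` are, under the same hypothesis on the edges;
* `simplyConnectedSpace_of_treeCover` — **`X` is simply connected** when the pieces are simply
  connected and the edge intersections path connected (Hatcher's Lemma 1.15 along the tree, from
  the tree's two-piece form `isSimplyConnected_union_of_isOpen`); hence `H₁(X) = 0`
  (`isZero_singularHomology_one_of_treeCover`, Hatcher Thm. 2A.1 in the tree).

Everything is proved; no definitions, no named facts (D-0026).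

## References

* A. Kosinski, *Differential Manifolds*, Academic Press (1993), VI.11, Prop. (11.5), and VI.12,
  pp. 119–122. [Kosinski1993]
* A. Hatcher, *Algebraic Topology*, CUP (2002), §2.2 pp. 149–150 (Mayer–Vietoris), Lemma 1.15,
  Thm. 2A.1. [HatcherAT2002]
-/

open scoped Topology
open Set Function CategoryTheory CategoryTheory.Limits

noncomputable section

namespace Literature.Topology.FourManifolds

open Literature.AlgebraicTopology.SingularHomology

variable {X : Type} [TopologicalSpace X]

/-! ### Two open pieces, set form -/

section TwoPieces

/-- `IsZero` is transported along homeomorphisms. [folklore] -/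
theorem isZero_singularHomology_of_homeomorph {A B : Type} [TopologicalSpace A]
    [TopologicalSpace B] (e : A ≃ₜ B) {n : ℕ} (h : IsZero (singularHomology ℤ ℤ A n)) :
    IsZero (singularHomology ℤ ℤ B n) :=
  h.of_iso (singularHomology.mapIso ℤ ℤ e n).symm

/-- **Mayer–Vietoris, vanishing, set form.** For open `A, B ⊆ X` with
`Hₙ₊₁(A ∩ B) = Hₙ(A ∩ B) = 0` and `Hₙ₊₁(A) = Hₙ₊₁(B) = 0`: `Hₙ₊₁(A ∪ B) = 0`.
[cite: HatcherAT2002, §2.2 p. 149] -/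
theorem isZero_singularHomology_union {A B : Set X} (hA : IsOpen A) (hB : IsOpen B) (n : ℕ)
    (h₁ : IsZero (singularHomology ℤ ℤ ↥(A ∩ B) (n + 1)))
    (h₀ : IsZero (singularHomology ℤ ℤ ↥(A ∩ B) n))
    (hA' : IsZero (singularHomology ℤ ℤ ↥A (n + 1)))
    (hB' : IsZero (singularHomology ℤ ℤ ↥B (n + 1))) :
    IsZero (singularHomology ℤ ℤ ↥(A ∪ B) (n + 1)) := by
  -- the cover of `T = A ∪ B` by the traces of `A` and `B`
  have hA₁ : IsOpen (Subtype.val ⁻¹' A : Set ↥(A ∪ B)) := hA.preimage continuous_subtype_val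
  have hB₁ : IsOpen (Subtype.val ⁻¹' B : Set ↥(A ∪ B)) := hB.preimage continuous_subtype_val
  have hcov : (Subtype.val ⁻¹' A : Set ↥(A ∪ B)) ∪ Subtype.val ⁻¹' B = univ := by
    ext ⟨x, hx⟩
    simpa using hx
  have eAB : ↥(Subtype.val ⁻¹' (A ∩ B) : Set ↥(A ∪ B)) ≃ₜ ↥(A ∩ B) :=
    ((Topology.IsEmbedding.subtypeVal.homeomorphImage _).trans (Homeomorph.setCongr (by rw [Subtype.image_preimage_coe, inter_eq_right.2 (inter_subset_left.trans subset_union_left)])))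
  have h₁' : IsZero (singularHomology ℤ ℤ
      ↥((Subtype.val ⁻¹' A : Set ↥(A ∪ B)) ∩ Subtype.val ⁻¹' B) (n + 1)) := by
    rw [← preimage_inter]; exact isZero_singularHomology_of_homeomorph eAB.symm h₁
  have h₀' : IsZero (singularHomology ℤ ℤ
      ↥((Subtype.val ⁻¹' A : Set ↥(A ∪ B)) ∩ Subtype.val ⁻¹' B) n) := by
    rw [← preimage_inter]; exact isZero_singularHomology_of_homeomorph eAB.symm h₀
  have eA : ↥(Subtype.val ⁻¹' A : Set ↥(A ∪ B)) ≃ₜ ↥A :=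
    ((Topology.IsEmbedding.subtypeVal.homeomorphImage _).trans (Homeomorph.setCongr (by rw [Subtype.image_preimage_coe, inter_eq_right.2 subset_union_left])))
  have eB : ↥(Subtype.val ⁻¹' B : Set ↥(A ∪ B)) ≃ₜ ↥B :=
    ((Topology.IsEmbedding.subtypeVal.homeomorphImage _).trans (Homeomorph.setCongr (by rw [Subtype.image_preimage_coe, inter_eq_right.2 subset_union_right])))
  haveI := mayerVietoris.isIso_ψ_of_isZero _ _ hA₁ hB₁ hcov n h₁' h₀'
  have hsrc : IsZero (singularHomology ℤ ℤ ↥(Subtype.val ⁻¹' A : Set ↥(A ∪ B)) (n + 1) ⊞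
      singularHomology ℤ ℤ ↥(Subtype.val ⁻¹' B : Set ↥(A ∪ B)) (n + 1)) :=
    (biprod_isZero_iff _ _).2
      ⟨isZero_singularHomology_of_homeomorph eA.symm hA',
        isZero_singularHomology_of_homeomorph eB.symm hB'⟩
  exact hsrc.of_iso (asIso (mayerVietoris.ψ ℤ ℤ (Subtype.val ⁻¹' A : Set ↥(A ∪ B))
    (Subtype.val ⁻¹' B) (n + 1))).symm

/-- **Mayer–Vietoris, splitting, set form.** For open `A, B ⊆ X` with
`Hₙ₊₁(A ∩ B) = Hₙ(A ∩ B) = 0`, read inside `T = A ∪ B` with the traces `A' = T ∩ A`,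
`B' = T ∩ B`: every class of `Hₙ₊₁(T)` is `i_{A*} a + i_{B*} b`, uniquely
(`i_{A*} a + i_{B*} b = 0 → a = 0 ∧ b = 0`). [cite: HatcherAT2002, §2.2 p. 149] -/
theorem singularHomology_union_decomp {A B : Set X} (hA : IsOpen A) (hB : IsOpen B) (n : ℕ)
    (h₁ : IsZero (singularHomology ℤ ℤ ↥(A ∩ B) (n + 1)))
    (h₀ : IsZero (singularHomology ℤ ℤ ↥(A ∩ B) n)) :
    (∀ x : singularHomology ℤ ℤ ↥(A ∪ B) (n + 1),
      ∃ (a : singularHomology ℤ ℤ ↥(Subtype.val ⁻¹' A : Set ↥(A ∪ B)) (n + 1))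
        (b : singularHomology ℤ ℤ ↥(Subtype.val ⁻¹' B : Set ↥(A ∪ B)) (n + 1)),
        x = singularHomology.map ℤ ℤ (subsetIncl (Subtype.val ⁻¹' A : Set ↥(A ∪ B))) (n + 1) a +
          singularHomology.map ℤ ℤ (subsetIncl (Subtype.val ⁻¹' B : Set ↥(A ∪ B))) (n + 1) b) ∧
    ∀ (a : singularHomology ℤ ℤ ↥(Subtype.val ⁻¹' A : Set ↥(A ∪ B)) (n + 1))
      (b : singularHomology ℤ ℤ ↥(Subtype.val ⁻¹' B : Set ↥(A ∪ B)) (n + 1)),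
      singularHomology.map ℤ ℤ (subsetIncl (Subtype.val ⁻¹' A : Set ↥(A ∪ B))) (n + 1) a +
          singularHomology.map ℤ ℤ (subsetIncl (Subtype.val ⁻¹' B : Set ↥(A ∪ B))) (n + 1) b = 0 →
        a = 0 ∧ b = 0 := by
  have hA₁ : IsOpen (Subtype.val ⁻¹' A : Set ↥(A ∪ B)) := hA.preimage continuous_subtype_val
  have hB₁ : IsOpen (Subtype.val ⁻¹' B : Set ↥(A ∪ B)) := hB.preimage continuous_subtype_val
  have hcov : (Subtype.val ⁻¹' A : Set ↥(A ∪ B)) ∪ Subtype.val ⁻¹' B = univ := by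
    ext ⟨x, hx⟩
    simpa using hx
  have eAB : ↥(Subtype.val ⁻¹' (A ∩ B) : Set ↥(A ∪ B)) ≃ₜ ↥(A ∩ B) :=
    ((Topology.IsEmbedding.subtypeVal.homeomorphImage _).trans (Homeomorph.setCongr (by rw [Subtype.image_preimage_coe, inter_eq_right.2 (inter_subset_left.trans subset_union_left)])))
  have h₁' : IsZero (singularHomology ℤ ℤ
      ↥((Subtype.val ⁻¹' A : Set ↥(A ∪ B)) ∩ Subtype.val ⁻¹' B) (n + 1)) := by
    rw [← preimage_inter]; exact isZero_singularHomology_of_homeomorph eAB.symm h₁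
  have h₀' : IsZero (singularHomology ℤ ℤ
      ↥((Subtype.val ⁻¹' A : Set ↥(A ∪ B)) ∩ Subtype.val ⁻¹' B) n) := by
    rw [← preimage_inter]; exact isZero_singularHomology_of_homeomorph eAB.symm h₀
  haveI := mayerVietoris.isIso_ψ_of_isZero _ _ hA₁ hB₁ hcov n h₁' h₀'
  set ψ := mayerVietoris.ψ ℤ ℤ (Subtype.val ⁻¹' A : Set ↥(A ∪ B)) (Subtype.val ⁻¹' B) (n + 1)
    with hψ
  have hinl : ∀ a, ψ ((biprod.inl : singularHomology ℤ ℤ ↥(Subtype.val ⁻¹' A : Set ↥(A ∪ B)) (n + 1) ⟶ singularHomology ℤ ℤ ↥(Subtype.val ⁻¹' A : Set ↥(A ∪ B)) (n + 1) ⊞ singularHomology ℤ ℤ ↥(Subtype.val ⁻¹' B : Set ↥(A ∪ B)) (n + 1)) a) =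
      singularHomology.map ℤ ℤ (subsetIncl (Subtype.val ⁻¹' A : Set ↥(A ∪ B))) (n + 1) a := by
    intro a
    rw [← ModuleCat.comp_apply, hψ, mayerVietoris.ψ, biprod.inl_desc]
  have hinr : ∀ b, ψ ((biprod.inr : singularHomology ℤ ℤ ↥(Subtype.val ⁻¹' B : Set ↥(A ∪ B)) (n + 1) ⟶ singularHomology ℤ ℤ ↥(Subtype.val ⁻¹' A : Set ↥(A ∪ B)) (n + 1) ⊞ singularHomology ℤ ℤ ↥(Subtype.val ⁻¹' B : Set ↥(A ∪ B)) (n + 1)) b) =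
      singularHomology.map ℤ ℤ (subsetIncl (Subtype.val ⁻¹' B : Set ↥(A ∪ B))) (n + 1) b := by
    intro b
    rw [← ModuleCat.comp_apply, hψ, mayerVietoris.ψ, biprod.inr_desc]
  refine ⟨fun x => ?_, fun a b hab => ?_⟩
  · refine ⟨(biprod.fst : singularHomology ℤ ℤ ↥(Subtype.val ⁻¹' A : Set ↥(A ∪ B)) (n + 1) ⊞ singularHomology ℤ ℤ ↥(Subtype.val ⁻¹' B : Set ↥(A ∪ B)) (n + 1) ⟶ singularHomology ℤ ℤ ↥(Subtype.val ⁻¹' A : Set ↥(A ∪ B)) (n + 1)) (inv ψ x),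
      (biprod.snd : singularHomology ℤ ℤ ↥(Subtype.val ⁻¹' A : Set ↥(A ∪ B)) (n + 1) ⊞ singularHomology ℤ ℤ ↥(Subtype.val ⁻¹' B : Set ↥(A ∪ B)) (n + 1) ⟶ singularHomology ℤ ℤ ↥(Subtype.val ⁻¹' B : Set ↥(A ∪ B)) (n + 1)) (inv ψ x), ?_⟩
    have hx : ψ (inv ψ x) = x := by
      rw [← ModuleCat.comp_apply, IsIso.inv_hom_id, ModuleCat.id_apply]
    have htot := ConcreteCategory.congr_hom (biprod.total : _ = 𝟙 (singularHomology ℤ ℤ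
      ↥(Subtype.val ⁻¹' A : Set ↥(A ∪ B)) (n + 1) ⊞
        singularHomology ℤ ℤ ↥(Subtype.val ⁻¹' B : Set ↥(A ∪ B)) (n + 1))) (inv ψ x)
    rw [ModuleCat.id_apply] at htot
    conv_lhs => rw [← hx, ← htot]
    have happ : ∀ y, ((biprod.fst ≫ (biprod.inl : singularHomology ℤ ℤ ↥(Subtype.val ⁻¹' A : Set ↥(A ∪ B)) (n + 1) ⟶ singularHomology ℤ ℤ ↥(Subtype.val ⁻¹' A : Set ↥(A ∪ B)) (n + 1) ⊞ singularHomology ℤ ℤ ↥(Subtype.val ⁻¹' B : Set ↥(A ∪ B)) (n + 1)) +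
        biprod.snd ≫ (biprod.inr : singularHomology ℤ ℤ ↥(Subtype.val ⁻¹' B : Set ↥(A ∪ B)) (n + 1) ⟶ singularHomology ℤ ℤ ↥(Subtype.val ⁻¹' A : Set ↥(A ∪ B)) (n + 1) ⊞ singularHomology ℤ ℤ ↥(Subtype.val ⁻¹' B : Set ↥(A ∪ B)) (n + 1)) : singularHomology ℤ ℤ ↥(Subtype.val ⁻¹' A : Set ↥(A ∪ B)) (n + 1) ⊞ singularHomology ℤ ℤ ↥(Subtype.val ⁻¹' B : Set ↥(A ∪ B)) (n + 1) ⟶ singularHomology ℤ ℤ ↥(Subtype.val ⁻¹' A : Set ↥(A ∪ B)) (n + 1) ⊞ singularHomology ℤ ℤ ↥(Subtype.val ⁻¹' B : Set ↥(A ∪ B)) (n + 1))) y =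
        (biprod.fst ≫ (biprod.inl : singularHomology ℤ ℤ ↥(Subtype.val ⁻¹' A : Set ↥(A ∪ B)) (n + 1) ⟶ singularHomology ℤ ℤ ↥(Subtype.val ⁻¹' A : Set ↥(A ∪ B)) (n + 1) ⊞ singularHomology ℤ ℤ ↥(Subtype.val ⁻¹' B : Set ↥(A ∪ B)) (n + 1))) y +
          (biprod.snd ≫ (biprod.inr : singularHomology ℤ ℤ ↥(Subtype.val ⁻¹' B : Set ↥(A ∪ B)) (n + 1) ⟶ singularHomology ℤ ℤ ↥(Subtype.val ⁻¹' A : Set ↥(A ∪ B)) (n + 1) ⊞ singularHomology ℤ ℤ ↥(Subtype.val ⁻¹' B : Set ↥(A ∪ B)) (n + 1))) y := by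
      intro y
      change (ModuleCat.Hom.hom (_ + _)) y = _
      rw [ModuleCat.hom_add]
      rfl
    rw [happ, map_add, ModuleCat.comp_apply, ModuleCat.comp_apply, hinl, hinr]
  · have hinj := (ModuleCat.mono_iff_injective ψ).1 inferInstance
    have hy : (biprod.inl : singularHomology ℤ ℤ ↥(Subtype.val ⁻¹' A : Set ↥(A ∪ B)) (n + 1) ⟶ singularHomology ℤ ℤ ↥(Subtype.val ⁻¹' A : Set ↥(A ∪ B)) (n + 1) ⊞ singularHomology ℤ ℤ ↥(Subtype.val ⁻¹' B : Set ↥(A ∪ B)) (n + 1)) a +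
        (biprod.inr : singularHomology ℤ ℤ ↥(Subtype.val ⁻¹' B : Set ↥(A ∪ B)) (n + 1) ⟶ singularHomology ℤ ℤ ↥(Subtype.val ⁻¹' A : Set ↥(A ∪ B)) (n + 1) ⊞ singularHomology ℤ ℤ ↥(Subtype.val ⁻¹' B : Set ↥(A ∪ B)) (n + 1)) b = 0 := by
      apply hinj
      rw [map_add, map_zero, hinl, hinr, hab]
    constructor
    · have := congrArg (biprod.fst : singularHomology ℤ ℤ
        ↥(Subtype.val ⁻¹' A : Set ↥(A ∪ B)) (n + 1) ⊞
          singularHomology ℤ ℤ ↥(Subtype.val ⁻¹' B : Set ↥(A ∪ B)) (n + 1) ⟶ _) hy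
      rwa [map_add, map_zero, ← ModuleCat.comp_apply, ← ModuleCat.comp_apply, biprod.inl_fst,
        biprod.inr_fst, ModuleCat.id_apply, show (0 : singularHomology ℤ ℤ
          ↥(Subtype.val ⁻¹' B : Set ↥(A ∪ B)) (n + 1) ⟶ _) b = 0 from rfl, add_zero] at this
    · have := congrArg (biprod.snd : singularHomology ℤ ℤ
        ↥(Subtype.val ⁻¹' A : Set ↥(A ∪ B)) (n + 1) ⊞
          singularHomology ℤ ℤ ↥(Subtype.val ⁻¹' B : Set ↥(A ∪ B)) (n + 1) ⟶ _) hy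
      rwa [map_add, map_zero, ← ModuleCat.comp_apply, ← ModuleCat.comp_apply, biprod.inl_snd,
        biprod.inr_snd, ModuleCat.id_apply, show (0 : singularHomology ℤ ℤ
          ↥(Subtype.val ⁻¹' A : Set ↥(A ∪ B)) (n + 1) ⟶ _) a = 0 from rfl, zero_add] at this

/-- **An internal direct sum of two free finitely generated pieces is free of the sum of the
ranks**: if every `x ∈ P` is `f a + g b` and `f a + g b = 0 → a = 0 ∧ b = 0` for linear maps
`f : M → P`, `g : N → P` from free finitely generated `ℤ`-modules, then `P` is free, finitely
generated, of rank `rank M + rank N` (a basis of `P` is `f ∘ b_M ⊔ g ∘ b_N`). [folklore] -/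
theorem free_of_decomp {M N P : Type} [AddCommGroup M] [Module ℤ M] [AddCommGroup N] [Module ℤ N]
    [AddCommGroup P] [Module ℤ P] [Module.Free ℤ M] [Module.Finite ℤ M] [Module.Free ℤ N]
    [Module.Finite ℤ N] (f : M →ₗ[ℤ] P) (g : N →ₗ[ℤ] P)
    (hsurj : ∀ x, ∃ a b, x = f a + g b) (hinj : ∀ a b, f a + g b = 0 → a = 0 ∧ b = 0) :
    Module.Free ℤ P ∧ Module.Finite ℤ P ∧
      Module.finrank ℤ P = Module.finrank ℤ M + Module.finrank ℤ N := by
  let bM := Module.Free.chooseBasis ℤ M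
  let bN := Module.Free.chooseBasis ℤ N
  have hf : Function.Injective f := by
    rw [← LinearMap.ker_eq_bot, LinearMap.ker_eq_bot']
    intro a ha
    exact (hinj a 0 (by rw [map_zero, add_zero, ha])).1
  have hg : Function.Injective g := by
    rw [← LinearMap.ker_eq_bot, LinearMap.ker_eq_bot']
    intro b hb
    exact (hinj 0 b (by rw [map_zero, zero_add, hb])).2
  -- the candidate basis
  let v : Module.Free.ChooseBasisIndex ℤ M ⊕ Module.Free.ChooseBasisIndex ℤ N → P :=
    Sum.elim (fun i => f (bM i)) (fun j => g (bN j))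
  have hli : LinearIndependent ℤ v := by
    refine linearIndependent_sum.2 ⟨?_, ?_, ?_⟩
    · change LinearIndependent ℤ (f ∘ bM)
      exact bM.linearIndependent.map' f (LinearMap.ker_eq_bot.2 hf)
    · change LinearIndependent ℤ (g ∘ bN)
      exact bN.linearIndependent.map' g (LinearMap.ker_eq_bot.2 hg)
    · rw [Submodule.disjoint_def]
      intro x hxM hxN
      change x ∈ Submodule.span ℤ (range (f ∘ bM)) at hxM
      change x ∈ Submodule.span ℤ (range (g ∘ bN)) at hxN
      rw [range_comp, ← Submodule.map_span, bM.span_eq, Submodule.map_top] at hxM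
      rw [range_comp, ← Submodule.map_span, bN.span_eq, Submodule.map_top] at hxN
      obtain ⟨a, rfl⟩ := LinearMap.mem_range.1 hxM
      obtain ⟨b, hb⟩ := LinearMap.mem_range.1 hxN
      have := (hinj a (-b) (by rw [map_neg, hb, add_neg_cancel])).1
      rw [this, map_zero]
  have hsp : ⊤ ≤ Submodule.span ℤ (range v) := by
    intro x _
    obtain ⟨a, b, rfl⟩ := hsurj x
    have hvM : Submodule.span ℤ (range (f ∘ bM)) ≤ Submodule.span ℤ (range v) :=
      Submodule.span_mono (by rintro _ ⟨i, rfl⟩; exact ⟨Sum.inl i, rfl⟩)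
    have hvN : Submodule.span ℤ (range (g ∘ bN)) ≤ Submodule.span ℤ (range v) :=
      Submodule.span_mono (by rintro _ ⟨j, rfl⟩; exact ⟨Sum.inr j, rfl⟩)
    refine Submodule.add_mem _ (hvM ?_) (hvN ?_)
    · rw [range_comp, ← Submodule.map_span, bM.span_eq, Submodule.map_top]
      exact LinearMap.mem_range_self f a
    · rw [range_comp, ← Submodule.map_span, bN.span_eq, Submodule.map_top]
      exact LinearMap.mem_range_self g b
  let bP := Module.Basis.mk hli hsp
  refine ⟨Module.Free.of_basis bP, Module.Finite.of_basis bP, ?_⟩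
  rw [Module.finrank_eq_card_basis bP, Fintype.card_sum,
    Module.finrank_eq_card_chooseBasisIndex, Module.finrank_eq_card_chooseBasisIndex]

/-- Consequence: `Hₙ₊₁(A ∪ B)` is free, finitely generated, of rank `rank Hₙ₊₁(A) + rank Hₙ₊₁(B)`
when `Hₙ₊₁(A)`, `Hₙ₊₁(B)` are free and finitely generated and `Hₙ₊₁(A ∩ B) = Hₙ(A ∩ B) = 0`.
[cite: HatcherAT2002, §2.2 p. 149] -/
theorem free_singularHomology_union {A B : Set X} (hA : IsOpen A) (hB : IsOpen B) (n : ℕ)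
    (h₁ : IsZero (singularHomology ℤ ℤ ↥(A ∩ B) (n + 1)))
    (h₀ : IsZero (singularHomology ℤ ℤ ↥(A ∩ B) n))
    [hAf : Module.Free ℤ (singularHomology ℤ ℤ ↥A (n + 1))]
    [hAfin : Module.Finite ℤ (singularHomology ℤ ℤ ↥A (n + 1))]
    [hBf : Module.Free ℤ (singularHomology ℤ ℤ ↥B (n + 1))]
    [hBfin : Module.Finite ℤ (singularHomology ℤ ℤ ↥B (n + 1))] :
    Module.Free ℤ (singularHomology ℤ ℤ ↥(A ∪ B) (n + 1)) ∧
      Module.Finite ℤ (singularHomology ℤ ℤ ↥(A ∪ B) (n + 1)) ∧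
      Module.finrank ℤ (singularHomology ℤ ℤ ↥(A ∪ B) (n + 1)) =
        Module.finrank ℤ (singularHomology ℤ ℤ ↥A (n + 1)) +
          Module.finrank ℤ (singularHomology ℤ ℤ ↥B (n + 1)) := by
  obtain ⟨hsurj, hinj⟩ := singularHomology_union_decomp hA hB n h₁ h₀
  -- transport freeness / finiteness / rank to the traces `A' ≅ A`, `B' ≅ B`
  have φA : ↥(Subtype.val ⁻¹' A : Set ↥(A ∪ B)) ≃ₜ ↥A :=
    ((Topology.IsEmbedding.subtypeVal.homeomorphImage _).trans (Homeomorph.setCongr (by rw [Subtype.image_preimage_coe, inter_eq_right.2 subset_union_left])))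
  have φB : ↥(Subtype.val ⁻¹' B : Set ↥(A ∪ B)) ≃ₜ ↥B :=
    ((Topology.IsEmbedding.subtypeVal.homeomorphImage _).trans (Homeomorph.setCongr (by rw [Subtype.image_preimage_coe, inter_eq_right.2 subset_union_right])))
  let eA := (singularHomology.mapIso ℤ ℤ φA (n + 1)).toLinearEquiv
  let eB := (singularHomology.mapIso ℤ ℤ φB (n + 1)).toLinearEquiv
  haveI := Module.Free.of_equiv eA.symm
  haveI := Module.Finite.equiv eA.symm
  haveI := Module.Free.of_equiv eB.symm
  haveI := Module.Finite.equiv eB.symm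
  obtain ⟨hF, hFin, hrank⟩ := free_of_decomp
    (singularHomology.map ℤ ℤ (subsetIncl (Subtype.val ⁻¹' A : Set ↥(A ∪ B))) (n + 1)).hom
    (singularHomology.map ℤ ℤ (subsetIncl (Subtype.val ⁻¹' B : Set ↥(A ∪ B))) (n + 1)).hom
    hsurj hinj
  refine ⟨hF, hFin, ?_⟩
  rw [hrank, ← eA.finrank_eq, ← eB.finrank_eq]

end TwoPieces

/-! ### Tree-shaped covers -/

section TreeCover

variable {r : ℕ} (U : Fin (r + 1) → Set X) (parent : Fin (r + 1) → Fin (r + 1))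

omit [TopologicalSpace X] in
/-- Membership in the partial union `⋃_{v ≤ i} Uᵥ`. [folklore] -/
theorem mem_biUnionLE_iff (i : ℕ) (x : X) :
    (x ∈ ⋃ (v : Fin (r + 1)) (_ : v.1 ≤ i), U v) ↔ ∃ v : Fin (r + 1), v.1 ≤ i ∧ x ∈ U v := by
  simp only [mem_iUnion, exists_prop]

omit [TopologicalSpace X] in
/-- `⋃_{v ≤ 0} Uᵥ = U₀`. [folklore] -/
theorem biUnionLE_zero : (⋃ (v : Fin (r + 1)) (_ : v.1 ≤ 0), U v) = U 0 := by
  ext x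
  rw [mem_biUnionLE_iff]
  constructor
  · rintro ⟨v, hv, hx⟩
    have : v = 0 := Fin.ext (by simpa using hv)
    exact this ▸ hx
  · exact fun hx => ⟨0, le_rfl, hx⟩

omit [TopologicalSpace X] in
/-- `⋃_{v ≤ i+1} Uᵥ = (⋃_{v ≤ i} Uᵥ) ∪ U_{i+1}` for `i + 1 ≤ r`. [folklore] -/
theorem biUnionLE_succ {i : ℕ} (hi : i + 1 < r + 1) :
    (⋃ (v : Fin (r + 1)) (_ : v.1 ≤ i + 1), U v) =
      (⋃ (v : Fin (r + 1)) (_ : v.1 ≤ i), U v) ∪ U ⟨i + 1, hi⟩ := by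
  ext x
  simp only [mem_union, mem_biUnionLE_iff]
  constructor
  · rintro ⟨v, hv, hx⟩
    rcases Nat.lt_or_eq_of_le hv with h | h
    · exact Or.inl ⟨v, Nat.lt_succ_iff.1 h, hx⟩
    · right
      have : v = ⟨i + 1, hi⟩ := Fin.ext h
      exact this ▸ hx
  · rintro (⟨v, hv, hx⟩ | hx)
    · exact ⟨v, hv.trans (Nat.le_succ i), hx⟩
    · exact ⟨⟨i + 1, hi⟩, le_rfl, hx⟩

omit [TopologicalSpace X] in
/-- `⋃_{v ≤ i} Uᵥ = X` for `r ≤ i` when the `Uᵥ` cover. [folklore] -/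
theorem biUnionLE_eq_univ (hcov : ⋃ v, U v = univ) {i : ℕ} (hi : r ≤ i) :
    (⋃ (v : Fin (r + 1)) (_ : v.1 ≤ i), U v) = univ := by
  refine eq_univ_of_forall fun x => ?_
  have hx : x ∈ ⋃ v, U v := hcov ▸ mem_univ x
  obtain ⟨v, hv⟩ := mem_iUnion.1 hx
  exact (mem_biUnionLE_iff U i x).2 ⟨v, (Nat.lt_succ_iff.1 v.2).trans hi, hv⟩

omit [TopologicalSpace X] in
/-- **The tree combinatorics.** If `parent v < v` for `v ≠ 0` and `Uᵥ` is disjoint from every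
earlier piece other than its parent, then `(⋃_{v ≤ i} Uᵥ) ∩ U_{i+1} = U_{i+1} ∩ U_{parent (i+1)}`.
[cite: Kosinski1993, VI.12 p. 121 (plumbing according to a tree)] -/
theorem biUnionLE_inter_eq (hpar : ∀ v, v ≠ 0 → parent v < v)
    (hdisj : ∀ v w, w < v → w ≠ parent v → Disjoint (U v) (U w)) {i : ℕ} (hi : i + 1 < r + 1) :
    (⋃ (v : Fin (r + 1)) (_ : v.1 ≤ i), U v) ∩ U ⟨i + 1, hi⟩ =
      U ⟨i + 1, hi⟩ ∩ U (parent ⟨i + 1, hi⟩) := by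
  have hp : parent ⟨i + 1, hi⟩ < ⟨i + 1, hi⟩ :=
    hpar _ (fun h => by simp [Fin.ext_iff] at h)
  ext x
  simp only [mem_inter_iff, mem_biUnionLE_iff]
  constructor
  · rintro ⟨⟨w, hw, hxw⟩, hx⟩
    refine ⟨hx, ?_⟩
    by_contra hxp
    have hne : w ≠ parent ⟨i + 1, hi⟩ := fun h => hxp (h ▸ hxw)
    have hlt : w < ⟨i + 1, hi⟩ := Fin.lt_def.2 (Nat.lt_succ_iff.2 hw)
    exact Set.disjoint_left.1 (hdisj _ _ hlt hne) hx hxw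
  · rintro ⟨hx, hxp⟩
    exact ⟨⟨parent ⟨i + 1, hi⟩, Nat.lt_succ_iff.1 (Fin.lt_def.1 hp), hxp⟩, hx⟩

/-- The partial unions are open. [folklore] -/
theorem isOpen_biUnionLE (hU : ∀ v, IsOpen (U v)) (i : ℕ) :
    IsOpen (⋃ (v : Fin (r + 1)) (_ : v.1 ≤ i), U v) :=
  isOpen_iUnion fun v => isOpen_iUnion fun _ => hU v

/-- **`Hₙ₊₁ = 0` for a tree-shaped union** (Mayer–Vietoris along the tree): if every piece has
`Hₙ₊₁(Uᵥ) = 0` and every edge intersection `Uᵥ ∩ U_{parent v}` has `Hₙ₊₁ = Hₙ = 0`, then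
`Hₙ₊₁(X) = 0`. (Kosinski VI.(11.5): `Hᵢ(B) = 0` for `0 < i ≠ k`, here for a plumbing read as a
union of open pieces.) [cite: Kosinski1993, VI.(11.5)] [cite: HatcherAT2002, §2.2 p. 149] -/
theorem isZero_singularHomology_of_treeCover (hpar : ∀ v, v ≠ 0 → parent v < v)
    (hU : ∀ v, IsOpen (U v)) (hcov : ⋃ v, U v = univ)
    (hdisj : ∀ v w, w < v → w ≠ parent v → Disjoint (U v) (U w)) (n : ℕ)
    (hmeet₁ : ∀ v, v ≠ 0 → IsZero (singularHomology ℤ ℤ ↥(U v ∩ U (parent v)) (n + 1)))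
    (hmeet₀ : ∀ v, v ≠ 0 → IsZero (singularHomology ℤ ℤ ↥(U v ∩ U (parent v)) n))
    (hpieces : ∀ v, IsZero (singularHomology ℤ ℤ ↥(U v) (n + 1))) :
    IsZero (singularHomology ℤ ℤ X (n + 1)) := by
  have key : ∀ i : ℕ, IsZero (singularHomology ℤ ℤ
      ↥(⋃ (v : Fin (r + 1)) (_ : v.1 ≤ i), U v) (n + 1)) := by
    intro i
    induction i with
    | zero => rw [biUnionLE_zero]; exact hpieces 0
    | succ i ih =>
      by_cases hi : i + 1 < r + 1
      · rw [biUnionLE_succ U hi]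
        have hne : (⟨i + 1, hi⟩ : Fin (r + 1)) ≠ 0 := fun h => by simp [Fin.ext_iff] at h
        refine isZero_singularHomology_union (isOpen_biUnionLE U hU i) (hU _) n ?_ ?_ ih
          (hpieces _)
        · rw [biUnionLE_inter_eq U parent hpar hdisj hi]; exact hmeet₁ _ hne
        · rw [biUnionLE_inter_eq U parent hpar hdisj hi]; exact hmeet₀ _ hne
      · rw [biUnionLE_eq_univ U hcov (by omega)]
        rw [biUnionLE_eq_univ U hcov (by omega)] at ih
        exact ih
  exact isZero_singularHomology_of_homeomorph (Homeomorph.Set.univ X)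
    ((biUnionLE_eq_univ U hcov le_rfl) ▸ key r)

/-- **`Hₙ₊₁` of a tree-shaped union is free of rank `Σᵥ rank Hₙ₊₁(Uᵥ)`** (Mayer–Vietoris along
the tree): if every `Hₙ₊₁(Uᵥ)` is free and finitely generated and every edge intersection has
`Hₙ₊₁ = Hₙ = 0`, then `Hₙ₊₁(X)` is free, finitely generated, of rank `Σᵥ rank Hₙ₊₁(Uᵥ)`.
(Kosinski VI.(11.5): `Hₖ(B) = gℤ` for a handlebody of genus `g`, here for a plumbing read as a
union of open pieces.) [cite: Kosinski1993, VI.(11.5)] [cite: HatcherAT2002, §2.2 p. 149] -/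
theorem free_singularHomology_of_treeCover (hpar : ∀ v, v ≠ 0 → parent v < v)
    (hU : ∀ v, IsOpen (U v)) (hcov : ⋃ v, U v = univ)
    (hdisj : ∀ v w, w < v → w ≠ parent v → Disjoint (U v) (U w)) (n : ℕ)
    (hmeet₁ : ∀ v, v ≠ 0 → IsZero (singularHomology ℤ ℤ ↥(U v ∩ U (parent v)) (n + 1)))
    (hmeet₀ : ∀ v, v ≠ 0 → IsZero (singularHomology ℤ ℤ ↥(U v ∩ U (parent v)) n))
    (hfree : ∀ v, Module.Free ℤ (singularHomology ℤ ℤ ↥(U v) (n + 1)))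
    (hfin : ∀ v, Module.Finite ℤ (singularHomology ℤ ℤ ↥(U v) (n + 1))) :
    Module.Free ℤ (singularHomology ℤ ℤ X (n + 1)) ∧
      Module.Finite ℤ (singularHomology ℤ ℤ X (n + 1)) ∧
      Module.finrank ℤ (singularHomology ℤ ℤ X (n + 1)) =
        ∑ v, Module.finrank ℤ (singularHomology ℤ ℤ ↥(U v) (n + 1)) := by
  -- invariant along the elimination order
  have key : ∀ i : ℕ, i < r + 1 →
      Module.Free ℤ (singularHomology ℤ ℤ ↥(⋃ (v : Fin (r + 1)) (_ : v.1 ≤ i), U v) (n + 1)) ∧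
      Module.Finite ℤ (singularHomology ℤ ℤ ↥(⋃ (v : Fin (r + 1)) (_ : v.1 ≤ i), U v) (n + 1)) ∧
      Module.finrank ℤ (singularHomology ℤ ℤ ↥(⋃ (v : Fin (r + 1)) (_ : v.1 ≤ i), U v) (n + 1)) =
        ∑ v ∈ Finset.univ.filter (fun v : Fin (r + 1) => v.1 ≤ i),
          Module.finrank ℤ (singularHomology ℤ ℤ ↥(U v) (n + 1)) := by
    intro i
    induction i with
    | zero =>
      intro _
      have h0 : Finset.univ.filter (fun v : Fin (r + 1) => v.1 ≤ 0) = {0} := by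
        ext v
        simp only [Finset.mem_filter, Finset.mem_univ, true_and, Finset.mem_singleton,
          Nat.le_zero, Fin.ext_iff, Fin.val_zero]
      rw [biUnionLE_zero, h0, Finset.sum_singleton]
      exact ⟨hfree 0, hfin 0, rfl⟩
    | succ i ih =>
      intro hi
      obtain ⟨ihfree, ihfin, ihrank⟩ := ih (by omega)
      have hne : (⟨i + 1, hi⟩ : Fin (r + 1)) ≠ 0 := fun h => by simp [Fin.ext_iff] at h
      haveI := ihfree
      haveI := ihfin
      haveI := hfree ⟨i + 1, hi⟩
      haveI := hfin ⟨i + 1, hi⟩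
      have h₁ : IsZero (singularHomology ℤ ℤ
          ↥((⋃ (v : Fin (r + 1)) (_ : v.1 ≤ i), U v) ∩ U ⟨i + 1, hi⟩) (n + 1)) := by
        rw [biUnionLE_inter_eq U parent hpar hdisj hi]; exact hmeet₁ _ hne
      have h₀ : IsZero (singularHomology ℤ ℤ
          ↥((⋃ (v : Fin (r + 1)) (_ : v.1 ≤ i), U v) ∩ U ⟨i + 1, hi⟩) n) := by
        rw [biUnionLE_inter_eq U parent hpar hdisj hi]; exact hmeet₀ _ hne
      obtain ⟨hF, hFin, hrank⟩ :=
        free_singularHomology_union (isOpen_biUnionLE U hU i) (hU ⟨i + 1, hi⟩) n h₁ h₀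
      have hfilter : Finset.univ.filter (fun v : Fin (r + 1) => v.1 ≤ i + 1) =
          insert ⟨i + 1, hi⟩ (Finset.univ.filter (fun v : Fin (r + 1) => v.1 ≤ i)) := by
        ext v
        simp only [Finset.mem_filter, Finset.mem_univ, true_and, Finset.mem_insert, Fin.ext_iff]
        omega
      have hnotin : (⟨i + 1, hi⟩ : Fin (r + 1)) ∉
          Finset.univ.filter (fun v : Fin (r + 1) => v.1 ≤ i) := by
        simp
      rw [biUnionLE_succ U hi, hfilter, Finset.sum_insert hnotin]
      refine ⟨hF, hFin, ?_⟩
      rw [hrank, ihrank]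
      exact Nat.add_comm _ _
  obtain ⟨hF, hFin, hrank⟩ := key r (Nat.lt_succ_self r)
  have hfilter : Finset.univ.filter (fun v : Fin (r + 1) => v.1 ≤ r) = Finset.univ := by
    ext v
    simp only [Finset.mem_filter, Finset.mem_univ, true_and, iff_true]
    exact Nat.lt_succ_iff.1 v.2
  rw [hfilter, biUnionLE_eq_univ U hcov le_rfl] at hrank
  rw [biUnionLE_eq_univ U hcov le_rfl] at hF hFin
  haveI := hF
  haveI := hFin
  let e := (singularHomology.mapIso ℤ ℤ (Homeomorph.Set.univ X) (n + 1)).toLinearEquiv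
  exact ⟨Module.Free.of_equiv e, Module.Finite.equiv e, by rw [← e.finrank_eq, hrank]⟩

/-- **A tree-shaped union of simply connected open pieces with path-connected edge
intersections is simply connected** (Hatcher's Lemma 1.15 along the tree). (Kosinski VI.(11.5):
a handlebody has the homotopy type of a wedge of spheres, in particular is simply connected for
`k ≥ 2`; here for a plumbing read as a union of open pieces.)
[cite: HatcherAT2002, Lemma 1.15] [cite: Kosinski1993, VI.(11.5)] -/
theorem simplyConnectedSpace_of_treeCover (hpar : ∀ v, v ≠ 0 → parent v < v)
    (hU : ∀ v, IsOpen (U v)) (hcov : ⋃ v, U v = univ)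
    (hdisj : ∀ v w, w < v → w ≠ parent v → Disjoint (U v) (U w))
    (hsc : ∀ v, IsSimplyConnected (U v))
    (hmeet : ∀ v, v ≠ 0 → IsPathConnected (U v ∩ U (parent v))) :
    SimplyConnectedSpace X := by
  have key : ∀ i : ℕ, IsSimplyConnected (⋃ (v : Fin (r + 1)) (_ : v.1 ≤ i), U v) := by
    intro i
    induction i with
    | zero => rw [biUnionLE_zero]; exact hsc 0
    | succ i ih =>
      by_cases hi : i + 1 < r + 1
      · rw [biUnionLE_succ U hi]
        have hne : (⟨i + 1, hi⟩ : Fin (r + 1)) ≠ 0 := fun h => by simp [Fin.ext_iff] at h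
        refine isSimplyConnected_union_of_isOpen (isOpen_biUnionLE U hU i) (hU _) ih (hsc _) ?_
        rw [biUnionLE_inter_eq U parent hpar hdisj hi]
        exact hmeet _ hne
      · rw [biUnionLE_eq_univ U hcov (by omega)]
        rw [biUnionLE_eq_univ U hcov (by omega)] at ih
        exact ih
  have huniv : IsSimplyConnected (univ : Set X) := (biUnionLE_eq_univ U hcov le_rfl) ▸ key r
  exact (Homeomorph.Set.univ X).toHomotopyEquiv.simplyConnectedSpace_iff.1 huniv

/-- Hence **`H₁(X; ℤ) = 0`** for such a union (Hatcher Thm. 2A.1, tree theorem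
`isZero_singularHomology_one_of_simplyConnectedSpace`). [cite: HatcherAT2002, Thm. 2A.1] -/
theorem isZero_singularHomology_one_of_treeCover (hpar : ∀ v, v ≠ 0 → parent v < v)
    (hU : ∀ v, IsOpen (U v)) (hcov : ⋃ v, U v = univ)
    (hdisj : ∀ v w, w < v → w ≠ parent v → Disjoint (U v) (U w))
    (hsc : ∀ v, IsSimplyConnected (U v))
    (hmeet : ∀ v, v ≠ 0 → IsPathConnected (U v ∩ U (parent v))) :
    IsZero (singularHomology ℤ ℤ X 1) := by
  haveI := simplyConnectedSpace_of_treeCover U parent hpar hU hcov hdisj hsc hmeet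
  exact isZero_singularHomology_one_of_simplyConnectedSpace ℤ ℤ

end TreeCover

end Literature.Topology.FourManifolds
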